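import Literature.AlgebraicGeometry.HodgeTheory.CyclicCoverSpecialisation
import Literature.AlgebraicGeometry.HodgeTheory.SpecialisedHypersurfaceFamilyPoints
import Literature.AlgebraicGeometry.HodgeTheory.CyclicCoverFormNonsingular
import HarnessLib

/-!
# The Carlson–Toledo universal family of cyclic covers of the plane, CONSTRUCTED; the Picard–Lefschetz
# package as a named fact; `nonempty_carlsonToledoFamily` from the package

Family `hodge`, layer `Literature/AlgebraicGeometry/HodgeTheory`. Written by the prover seat `hodge-nonav-prover-Ax`
(g4) for route `CyclicUnitaryPowers` of the Hodge summit (crux K1 `VeryGeneralDeckCommutatorsInHg`,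
stmt-HodgeConjecture-19544; the split (3a)/(3b) of the residual fact `nonempty_carlsonToledoFamily` recorded in
the cell memo `K1A-RESIDUAL-FACTS-SCOPING-Bx-g5`). ONE new named fact (`carlsonToledo1999_cyclicReflectionSystem`,
§6 — the Picard–Lefschetz CONTENT of the bundled fact `nonempty_carlsonToledoFamily`, for the family constructed
here), everything else proved.

## Contents

* §4 **The family** (Carlson–Toledo §2, "`𝒴 = {(x, y, a) : y^k + Σ a_L x^L = 0}` … the quotient `𝒴` in
  `Ũ × ℙ³`", `k = d = p`, `n = 1`): `cyclicCoverFamily p : cyclicCoverTotal p ⟶ cyclicCoverBase p` — the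
  specialised family (`Motives/SpecialisedHypersurfaceFamily`) of the coefficient specialisation
  `cyclicCoverSpz p` (`a_{x₃^p} ↦ 1`, `a_{(e,0)} ↦ −b_e`, file `CyclicCoverSpecialisation`); it is a smooth
  projective family of surfaces over the smooth irreducible quasi-projective base `S = Ũ` (ternary `p`-forms with
  nonsingular cyclic cover form, open in `ℂ^{N+1}`; irreducible through the Fermat point), with quasi-projective
  total space and `R² u_* ℚ` a local system (Ehresmann); the classifying map `cyclicCoverPoint p : f ↦ [x₃^p − f]`,
  whose fibre is the model `X_F` (`nonempty_fiberOver_cyclicCoverFamily_iso`), and **`exists_polynomials`**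
  (`cyclicCoverPoint_exists_polynomials`: Zariski-closed sets of `S(ℂ)` are cut out on classified forms by
  polynomials in the coefficients — via `isNonsingularForm_cyclicCoverForm_of_isSmoothProjective`).
* §5 **`pt_surjective`** (`cyclicCoverPoint_surjective`): every point `t ∈ S(ℂ)` is `[x₃^p − f_t]` for its own
  branch form `f_t ≠ 0`, with `X` smooth projective.
* §6 the named fact `carlsonToledo1999_cyclicReflectionSystem` (CT §3, §6 Prop., §7 last ¶, with the §2
  identification of the fibre and of the covering automorphism) and
  **`nonempty_carlsonToledoFamily_of_cyclicReflectionSystem`**: the tree's bundled cited fact FOLLOWS from it —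
  its construction half is a theorem (`carlsonToledoFamilyOfSystem`).

## References

* J. A. Carlson, D. Toledo, Discriminant complements and kernels of monodromy representations, Duke Math. J. 97
  (1999), §2 (universalcyclic), §3, §6 Proposition, §7 last paragraph (held text p0004–p0007, p0013–p0016).
  [CarlsonToledo1999]
* C. Voisin, *Hodge Theory and Complex Algebraic Geometry I* (2002), Thm. 9.3 (Ehresmann); *II* (2003), §6.2.1.
  [VoisinHodgeI2002] [VoisinHodgeII2003]
* R. Hartshorne, *Algebraic Geometry* (1977), I Ex. 5.5, 5.8; II §3, §4. [Hartshorne1977]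
-/

noncomputable section

namespace Literature.AlgebraicGeometry.HodgeTheory

open CategoryTheory
open Literature.AlgebraicGeometry.Motives Literature.AlgebraicGeometry.Motives.UniversalHypersurface
open Literature.AlgebraicGeometry.HodgeTheory.UniversalHypersurface

/-! ### §4 The Carlson–Toledo family `u : 𝒴 ⟶ S` of smooth cyclic covers of the plane -/

section Family

variable (p : ℕ)

/-- **The base `S = Ũ` of the Carlson–Toledo family**: the Zariski open set of ternary `p`-forms `f`
(coordinates `b_e = coeff_e f`, `ℂ^{N+1}`) whose cyclic cover form `x₃^p − f` is nonsingular
(`baseSpz` of the specialisation `φ_p`; "`Ũ = ℂ^{N+1} − Δ̃`"). [cite: CarlsonToledo1999, §2 (held text p0004)] -/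
abbrev cyclicCoverBase : SchemeOver ℂ := baseSpz ℂ 2 p (cyclicCoverSpz p)

/-- **The total space `𝒴` of the Carlson–Toledo family** ("`𝒴 = {(x, y, a) : y^k + Σ a_L x^L = 0}` … view
`𝒴` in `Ũ × ℙ³`"): the base change of the universal smooth quaternary `p`-ic along `S ⟶ U`.
[cite: CarlsonToledo1999, §2 (universalcyclic) (held text p0004–p0005)] -/
abbrev cyclicCoverTotal : SchemeOver ℂ := totalSpz ℂ 2 p (cyclicCoverSpz p)

/-- **The Carlson–Toledo universal family of cyclic covers of the plane** `u : 𝒴 ⟶ S`, `(x, a) ↦ a`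
(`familySpz` of `φ_p`). [cite: CarlsonToledo1999, §2 (universalcyclic) (held text p0004–p0005)] -/
abbrev cyclicCoverFamily : cyclicCoverTotal p ⟶ cyclicCoverBase p := familySpz ℂ 2 p (cyclicCoverSpz p)

/-- `u` is a smooth projective family of surfaces (`p ≥ 1`). [cite: CarlsonToledo1999, §2 (held text p0004)] -/
theorem isSmoothProjectiveFamily_cyclicCoverFamily [NeZero p] : IsSmoothProjectiveFamily (cyclicCoverFamily p) 2 :=
  isSmoothProjectiveFamily_familySpz ℂ 2 p _ (by norm_num) NeZero.one_le

/-- `R² u_* ℚ` is a local system on all of `S(ℂ)` (Ehresmann). [cite: VoisinHodgeI2002, Thm. 9.3 and §9.2.1] -/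
theorem cyclicCoverFamily_locallyTrivial [NeZero p] :
    IsCohomologicallyLocallyTrivialOn (cyclicCoverFamily p) (Set.univ : Set (ComplexPoints (cyclicCoverBase p))) :=
  isCohomologicallyLocallyTrivialOn_familySpz 2 p _ (by norm_num) NeZero.one_le

/-- The Fermat branch form `−(x₀^p + x₁^p + x₂^p)`: its cyclic cover is the Fermat surface `Σ_{i<4} x_i^p = 0`.
[cite: Hartshorne1977, I Ex. 5.5] -/
def fermatBranchForm : MvPolynomial (Fin 3) ℂ := -∑ j : Fin 3, MvPolynomial.X j ^ p

/-- `x₃^p − (−Σ_{j<3} x_j^p) = Σ_{i<4} x_i^p`. [cite: Hartshorne1977, I Ex. 5.5] -/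
theorem cyclicCoverForm_fermatBranchForm :
    cyclicCoverForm p (fermatBranchForm p) = ∑ i : Fin 4, (MvPolynomial.X i : MvPolynomial (Fin 4) ℂ) ^ p := by
  rw [cyclicCoverForm_def, fermatBranchForm, map_neg, sub_neg_eq_add, map_sum,
    Fin.sum_univ_castSucc (f := fun i : Fin 4 => (MvPolynomial.X i : MvPolynomial (Fin 4) ℂ) ^ p), add_comm]
  simp only [map_pow, MvPolynomial.rename_X]

/-- The Fermat branch form is homogeneous of degree `p`. [cite: Hartshorne1977, I Ex. 5.5] -/
theorem isHomogeneous_fermatBranchForm : (fermatBranchForm p).IsHomogeneous p :=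
  (MvPolynomial.IsHomogeneous.sum _ _ _ fun j _ => MvPolynomial.isHomogeneous_X_pow j p).neg

/-- The Fermat cyclic cover form is nonsingular (`p ≠ 0` in `ℂ`). [cite: Hartshorne1977, I Ex. 5.5] -/
theorem isNonsingularForm_cyclicCoverForm_fermatBranchForm [NeZero p] :
    SmoothHypersurface.IsNonsingularForm ℂ (cyclicCoverForm p (fermatBranchForm p)) := by
  rw [cyclicCoverForm_fermatBranchForm]
  exact SmoothHypersurface.isNonsingularForm_sum_X_pow (Nat.cast_ne_zero.2 (NeZero.ne p))

/-- The Fermat point of the base `S(ℂ)` (so `S` is non-empty and irreducible). [cite: CarlsonToledo1999, §2 (held text p0004)] -/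
def cyclicCoverBasePoint [NeZero p] : ComplexPoints (cyclicCoverBase p) :=
  pointOfFormSpz ℂ 2 p (cyclicCoverSpz p)
    (CyclicCoverFormNonsingular.isHomogeneous_cyclicCoverForm_of_isHomogeneous (isHomogeneous_fermatBranchForm p))
    (isNonsingularForm_cyclicCoverForm_fermatBranchForm p) (ternaryCoeffHom_comp_cyclicCoverSpz p (NeZero.ne p) _)

/-- **`S` is irreducible** (a non-empty open subset of the affine space `ℂ^{N+1}`).
[cite: CarlsonToledo1999, §2 (held text p0004)] -/
theorem irreducibleSpace_cyclicCoverBase [NeZero p] : IrreducibleSpace (cyclicCoverBase p).left :=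
  irreducibleSpace_baseSpz_left ℂ 2 p _ ⟨(cyclicCoverBasePoint p).pt⟩

open scoped Classical in
/-- **The classifying map** `pt : f ↦ [x₃^p − f] ∈ S(ℂ)` on the ternary `p`-forms with nonsingular cyclic
cover form (the Fermat point on the other polynomials — a documented junk value making the map total).
[cite: CarlsonToledo1999, §2 (held text p0004)] -/
def cyclicCoverPoint [NeZero p] (f : MvPolynomial (Fin 3) ℂ) : ComplexPoints (cyclicCoverBase p) :=
  if h : f.IsHomogeneous p ∧ SmoothHypersurface.IsNonsingularForm ℂ (cyclicCoverForm p f) then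
    pointOfFormSpz ℂ 2 p (cyclicCoverSpz p)
      (CyclicCoverFormNonsingular.isHomogeneous_cyclicCoverForm_of_isHomogeneous h.1) h.2
      (ternaryCoeffHom_comp_cyclicCoverSpz p (NeZero.ne p) f)
  else cyclicCoverBasePoint p

/-- On good forms the classifying map is the point `[x₃^p − f]_{ψ_f}`. [cite: CarlsonToledo1999, §2 (held text p0004)] -/
theorem cyclicCoverPoint_eq [NeZero p] {f : MvPolynomial (Fin 3) ℂ} (hf : f.IsHomogeneous p)
    (hJ : SmoothHypersurface.IsNonsingularForm ℂ (cyclicCoverForm p f)) :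
    cyclicCoverPoint p f = pointOfFormSpz ℂ 2 p (cyclicCoverSpz p)
      (CyclicCoverFormNonsingular.isHomogeneous_cyclicCoverForm_of_isHomogeneous hf) hJ
      (ternaryCoeffHom_comp_cyclicCoverSpz p (NeZero.ne p) f) := by
  classical
  exact dif_pos ⟨hf, hJ⟩

/-- **The fibre of `u` over `pt f` is the model `X_F = V(x₃^p − f) ⊂ ℙ³`** (for `f` homogeneous with
nonsingular cyclic cover form). [cite: CarlsonToledo1999, §2 (universalcyclic) (held text p0004–p0005)] -/
theorem nonempty_fiberOver_cyclicCoverFamily_iso [NeZero p] {f : MvPolynomial (Fin 3) ℂ} (hf : f.IsHomogeneous p)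
    (hJ : SmoothHypersurface.IsNonsingularForm ℂ (cyclicCoverForm p f)) :
    Nonempty (fiberOver (cyclicCoverFamily p) (cyclicCoverPoint p f) ≅
      SmoothHypersurface.hypersurface (cyclicCoverForm p f)) := by
  rw [cyclicCoverPoint_eq p hf hJ]
  exact nonempty_fiberOver_familySpz_iso_hypersurface ℂ 2 p _ (Nat.pos_of_ne_zero (NeZero.ne p)) _ hJ _

/-- **Zariski-closed subsets of `S(ℂ)` are cut out, on classified forms, by polynomials in the coefficients
`(coeff_e f)_{|e| = p}`** (`p ≥ 2`; the clause `exists_polynomials` of `CarlsonToledoFamily`): a smooth model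
`X_F` with `f ≠ 0` has nonsingular form (`isNonsingularForm_cyclicCoverForm_of_isSmoothProjective`), so it is
classified by `[x₃^p − f]_{ψ_f}`, and `exists_polynomials_baseSpz` applies. [cite: CarlsonToledo1999, §2 (held text p0004)] -/
theorem cyclicCoverPoint_exists_polynomials [NeZero p] (hp : 2 ≤ p) (W : Set (ComplexPoints (cyclicCoverBase p)))
    (hW : IsZariskiClosedOnPoints (cyclicCoverBase p) W) :
    ∃ G : Set (MvPolynomial (TernaryIndex p) ℂ), ∀ f : MvPolynomial (Fin 3) ℂ,
      f.IsHomogeneous p → f ≠ 0 → IsSmoothProjective 2 (SmoothHypersurface.hypersurface (cyclicCoverForm p f)) →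
        (cyclicCoverPoint p f ∈ W ↔
          ∀ g ∈ G, MvPolynomial.eval (fun d : TernaryIndex p => f.coeff d.1) g = 0) := by
  obtain ⟨G, hG⟩ := exists_polynomials_baseSpz ℂ 2 p (cyclicCoverSpz p) W hW
  refine ⟨G, fun f hf hf0 hX => ?_⟩
  have hJ := CyclicCoverFormNonsingular.isNonsingularForm_cyclicCoverForm_of_isSmoothProjective hp hf hf0 hX
  rw [cyclicCoverPoint_eq p hf hJ, hG]
  simp only [eval_coeff_eq_ternaryCoeffHom]

end Family

/-! ### §5 Every point of `S(ℂ)` classifies a non-zero ternary `p`-form with smooth cyclic cover -/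

section Surjective

variable (p : ℕ)

/-- The ternary form `f_t = Σ_e t(b_e) x^e` of a point `t ∈ S(ℂ)`. [cite: CarlsonToledo1999, §2 (held text p0004)] -/
def branchForm (t : ComplexPoints (cyclicCoverBase p)) : MvPolynomial (Fin 3) ℂ :=
  ∑ e : TernaryIndex p, MvPolynomial.monomial e.1 (pointAlgHomSpz ℂ 2 p (cyclicCoverSpz p) t (MvPolynomial.X e))

/-- The coefficients of `f_t`: `coeff_e f_t = t(b_e)`. [cite: CarlsonToledo1999, §2 (held text p0004)] -/
theorem coeff_branchForm (t : ComplexPoints (cyclicCoverBase p)) (e : TernaryIndex p) :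
    (branchForm p t).coeff e.1 = pointAlgHomSpz ℂ 2 p (cyclicCoverSpz p) t (MvPolynomial.X e) := by
  classical
  rw [branchForm, MvPolynomial.coeff_sum]
  simp only [MvPolynomial.coeff_monomial]
  rw [Finset.sum_eq_single e (fun b _ hb => if_neg fun h => hb (Subtype.ext h))
    (fun h => absurd (Finset.mem_univ _) h), if_pos rfl]

/-- `f_t` is homogeneous of degree `p`. [cite: CarlsonToledo1999, §2 (held text p0004)] -/
theorem isHomogeneous_branchForm (t : ComplexPoints (cyclicCoverBase p)) : (branchForm p t).IsHomogeneous p :=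
  MvPolynomial.IsHomogeneous.sum _ _ _ fun e _ => MvPolynomial.isHomogeneous_monomial _ e.2

/-- `ψ_{f_t} = ψ_t`. [cite: CarlsonToledo1999, §2 (held text p0004)] -/
theorem ternaryCoeffHom_branchForm (t : ComplexPoints (cyclicCoverBase p)) :
    ternaryCoeffHom p (branchForm p t) = pointAlgHomSpz ℂ 2 p (cyclicCoverSpz p) t :=
  MvPolynomial.algHom_ext fun e => by rw [ternaryCoeffHom_X, coeff_branchForm]

/-- **`x₃^p − f_t` is the form of the point `t`.** [cite: CarlsonToledo1999, §2 (universalcyclic) (held text p0004)] -/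
theorem cyclicCoverForm_branchForm [NeZero p] (t : ComplexPoints (cyclicCoverBase p)) :
    cyclicCoverForm p (branchForm p t) = pointFormSpz ℂ 2 p (cyclicCoverSpz p) t :=
  eq_of_coeffHom_eq (CyclicCoverFormNonsingular.isHomogeneous_cyclicCoverForm_of_isHomogeneous (isHomogeneous_branchForm p t))
    (isHomogeneous_pointForm ℂ 2 p _)
    (by rw [← ternaryCoeffHom_comp_cyclicCoverSpz p (NeZero.ne p), ternaryCoeffHom_branchForm, pointAlgHomSpz_comp])

/-- **Every point of `S(ℂ)` classifies a non-zero ternary `p`-form with smooth cyclic cover** (`p ≥ 2`; the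
clause `pt_surjective` of `CarlsonToledoFamily`): `t = pt f_t`, the form `x₃^p − f_t` of `t` being nonsingular
(so `X` is smooth projective and `f_t ≠ 0`, as `x₃^p` alone is singular).
[cite: CarlsonToledo1999, §2 (universalcyclic) (held text p0004–p0005)] -/
theorem cyclicCoverPoint_surjective [NeZero p] (hp : 2 ≤ p) (t : ComplexPoints (cyclicCoverBase p)) :
    ∃ f : MvPolynomial (Fin 3) ℂ, f.IsHomogeneous p ∧ f ≠ 0 ∧
      IsSmoothProjective 2 (SmoothHypersurface.hypersurface (cyclicCoverForm p f)) ∧ cyclicCoverPoint p f = t := by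
  have hF := cyclicCoverForm_branchForm p t
  have hJ : SmoothHypersurface.IsNonsingularForm ℂ (cyclicCoverForm p (branchForm p t)) := by
    rw [hF]; exact isNonsingularForm_pointForm ℂ 2 p _
  refine ⟨branchForm p t, isHomogeneous_branchForm p t, ?_, ?_, ?_⟩
  · intro h0
    rw [h0] at hJ
    exact CyclicCoverFormNonsingular.not_isNonsingularForm_cyclicCoverForm_zero hp hJ
  · rw [hF]
    exact isSmoothProjective_hypersurface_pointFormSpz ℂ 2 p _ (by norm_num) (by omega) t
  · rw [cyclicCoverPoint_eq p (isHomogeneous_branchForm p t) hJ]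
    exact (pointOfFormSpz_eq_of_eq ℂ 2 p _ _ _ _ _ _ _ (ternaryCoeffHom_branchForm p t)).trans
      (pointOfFormSpz_pointFormSpz ℂ 2 p (cyclicCoverSpz p) t)

end Surjective


/-! ### §6 The Picard–Lefschetz package (named fact) and the Carlson–Toledo structure -/

section PicardLefschetz

open Literature.AlgebraicTopology.SingularHomology

/-- **Named fact (Carlson–Toledo 1999, §3, §6 Proposition, §7 last paragraph — the Picard–Lefschetz package of
the universal family of cyclic covers of the plane; case `n = 1`, `k = d = p`).** For every odd `p ≥ 3` and every
point `[x₃^p − f]` of the Carlson–Toledo family `cyclicCoverFamily p : 𝒴 ⟶ S` of smooth `p`-cyclic covers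
`X_F = V(x₃^p − f) ⊂ ℙ³` of `ℙ²` (`f ≠ 0` a ternary `p`-form with `X_F` smooth; the family, its base — the smooth
irreducible quasi-projective space `Ũ` of such `f` (§2) — its fibres and its classifying map are CONSTRUCTED in
this file): there are an identification `e` of the fibre `𝒴_{[F]}` with the model `X_F` and an automorphism `τ`
of `H²(𝒴_{[F]}(ℂ); ℚ)` which `e` intertwines with the deck transformation `σ_F^*`, `σ_F : x₃ ↦ ζ_p x₃` ("the
cyclic action on the universal family (universalcyclic) be given by `y ∘ σ = ζ y`", §2; `τ` = the covering
automorphism read on the fibre), such that the monodromy group `Γ` of `R² u_* ℚ` at `[F]`, the cup-product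
form transported from `X_F` along `e`, and `τ` form a CYCLIC REFLECTION SYSTEM (`CyclicReflectionSystem`,
file `CyclicCoverReflectionMonodromy`): `Γ` is generated by the local monodromies of the meridians of the
(irreducible) discriminant (§3, Zariski–van Kampen), each of which is the cyclic reflection — the covering
automorphism on the `(p−1)`-dimensional, non-degenerate, `τ`-invariant-free vanishing space of an
`A_{p−1}`-degeneration, the identity on its orthogonal (§6, Proposition with `λ_i = (−1)^{n+1}ζ^i = ζ^i`) —
the vanishing spaces forming ONE `Γ`-orbit and spanning the `τ`-anti-invariant part of `H²` (§7, last
paragraph). This is exactly the field `system` (with `iso`, `deck`, `pullEquiv_deck`) of the tree's bundled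
fact `nonempty_carlsonToledoFamily`, separated from the construction of the family, which is PROVED here
(`nonempty_carlsonToledoFamily_of_cyclicReflectionSystem`).
`-- TODO(general form): CT99 treat d-fold cyclic covers of ℙⁿ branched along degree-k hypersurfaces, d ∣ k.`
[cite: CarlsonToledo1999, §2 (universalcyclic), §3, §6 Proposition, §7 last paragraph (held text p0004–p0007, p0013–p0016)] -/
def carlsonToledo1999_cyclicReflectionSystem : Prop :=
  ∀ ⦃p : ℕ⦄ [NeZero p], Odd p → 3 ≤ p →
    ∀ (f : MvPolynomial (Fin 3) ℂ), f.IsHomogeneous p → f ≠ 0 →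
    ∀ (hX : IsSmoothProjective 2 (SmoothHypersurface.hypersurface (cyclicCoverForm p f))),
    ∃ (e : fiberOver (cyclicCoverFamily p) (cyclicCoverPoint p f) ≅
          SmoothHypersurface.hypersurface (cyclicCoverForm p f))
      (τ : bettiCohomology (fiberOver (cyclicCoverFamily p) (cyclicCoverPoint p f)) 2 ≃ₗ[ℚ]
        bettiCohomology (fiberOver (cyclicCoverFamily p) (cyclicCoverPoint p f)) 2),
      (∀ (ha : deckUnit p ∈ diagonalStabilizer (cyclicCoverForm p f))
          (x : bettiCohomology (fiberOver (cyclicCoverFamily p) (cyclicCoverPoint p f)) 2),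
          BettiUniverse.pullEquiv e 2 (τ x) =
            BettiUniverse.pull (diagonalAut (cyclicCoverForm p f) ha) 2 (BettiUniverse.pullEquiv e 2 x)) ∧
      Nonempty (CyclicReflectionSystem
        (ratMonodromyGroup (cyclicCoverFamily p) 2 (cyclicCoverFamily_locallyTrivial p)
          ⟨cyclicCoverPoint p f, Set.mem_univ _⟩)
        (transportedTraceForm hX e 2) τ p)

/-- **The Carlson–Toledo structure of the tree's cited fact `nonempty_carlsonToledoFamily`, ASSEMBLED from the
constructed family and the Picard–Lefschetz package**: for odd `p ≥ 3`, the family `cyclicCoverFamily p` with its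
proved properties (smooth projective family of surfaces; quasi-projective, smooth, irreducible base; quasi-projective
total space; Ehresmann; the classifying map `cyclicCoverPoint` with `exists_polynomials` and `pt_surjective`
PROVED), together with the identification `e`, the covering automorphism `τ` and the cyclic reflection system
supplied by `carlsonToledo1999_cyclicReflectionSystem`.
[cite: CarlsonToledo1999, §2, §3, §6 Proposition, §7 last paragraph (held text p0004–p0007, p0013–p0016)] -/
def carlsonToledoFamilyOfSystem (h : carlsonToledo1999_cyclicReflectionSystem) {p : ℕ} (hodd : Odd p)
    (h3 : 3 ≤ p) : CarlsonToledoFamily p :=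
  haveI : NeZero p := ⟨by omega⟩
  have hp2 : 2 ≤ p := by omega
  { Y := cyclicCoverTotal p
    S := cyclicCoverBase p
    u := cyclicCoverFamily p
    isSmoothProjectiveFamily := isSmoothProjectiveFamily_cyclicCoverFamily p
    isQuasiProjectiveOver := isQuasiProjectiveOver_baseSpz 2 p (cyclicCoverSpz p)
    isQuasiProjectiveOver_total :=
      isQuasiProjectiveOver_totalSpz 2 p (cyclicCoverSpz p) (cyclicCoverSpz_surjective p (NeZero.ne p))
    smooth := smooth_baseSpz_hom ℂ 2 p (cyclicCoverSpz p)
    irreducibleSpace := irreducibleSpace_cyclicCoverBase p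
    locallyTrivial := cyclicCoverFamily_locallyTrivial p
    pt := cyclicCoverPoint p
    exists_polynomials := cyclicCoverPoint_exists_polynomials p hp2
    pt_surjective := cyclicCoverPoint_surjective p hp2
    iso := fun f hf hf0 hX => (h hodd h3 f hf hf0 hX).choose
    deck := fun f hf hf0 hX => (h hodd h3 f hf hf0 hX).choose_spec.choose
    pullEquiv_deck := fun f hf hf0 hX ha x => (h hodd h3 f hf hf0 hX).choose_spec.choose_spec.1 ha x
    system := fun f hf hf0 hX => ((h hodd h3 f hf hf0 hX).choose_spec.choose_spec.2).some }

/-- **`nonempty_carlsonToledoFamily` FOLLOWS from the Picard–Lefschetz package alone**: the construction half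
(CT §2: the family, its fibres, the algebraicity of its base, Ehresmann) of the tree's bundled cited fact is a
theorem. [cite: CarlsonToledo1999, §2, §3, §6 Proposition, §7 last paragraph (held text p0004–p0007, p0013–p0016)] -/
theorem nonempty_carlsonToledoFamily_of_cyclicReflectionSystem (h : carlsonToledo1999_cyclicReflectionSystem) :
    nonempty_carlsonToledoFamily :=
  fun _ hodd h3 => ⟨carlsonToledoFamilyOfSystem h hodd h3⟩

end PicardLefschetz

end Literature.AlgebraicGeometry.HodgeTheory

end
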